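import Literature.Analysis.PDE.FrameOpSmooth
import Literature.Analysis.PDE.ParabolicJointSmoothness
import Literature.Analysis.PDE.SobolevSupBound
import Literature.Analysis.PDE.SlabEnergyBounds
import Literature.Analysis.PDE.SlabCoefficientBounds
import Literature.Analysis.PDE.AffineWordBounds
import Literature.Analysis.PDE.JetComposition
import Literature.Analysis.Calculus.SlabUniformLimits
import HarnessLib

/-!
# Tools for limits of slab families: words, energies, uniform Cauchy limits, passage in equations
# (topic `Analysis/PDE`)

Generic toolkit of the linear (`LinExist.lean`) and quasilinear (`QuasilinearPicard.lean`)
existence theorems of the programme to prove short-time existence for quasilinear strictly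
parabolic systems on a closed manifold (hypothesis `hQL` of
`Literature.Geometry.Riemannian.ricciFlow_shortTime_existence_of_quasilinear`):

* energies and sup bounds of frame-word derivatives (`sobolevEnergy_iterDirDeriv_le`,
  `enorm_iterDirDeriv_sq_le`), commutation of word and time derivatives
  (`timeDerivWithin_iterDirDeriv`);
* limits of slab families with uniformly Cauchy frame words
  (`exists_slab_limit_of_words_cauchy`);
* word derivatives of frame operators of functions with small frame words
  (`norm_iterDirDeriv_frameOp_le`);
* passage to the limit in a represented linear equation, word by word
  (`hasDerivWithinAt_words_of_limit`).

Everything is proved; no named fact and no `sorry` is introduced.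

## References

* L. C. Evans, *Partial Differential Equations*, 2nd ed., AMS 2010, §5.6.3 and §7.1.2–§7.1.3.
  [Evans2010]
* J. Dieudonné, *Foundations of Modern Analysis*, Academic Press 1960, (8.6.3). [Dieudonne1960]
-/

noncomputable section

open Set Function Filter Topology Metric MeasureTheory InnerProductSpace
open scoped ContDiff Topology ENNReal RealInnerProductSpace

namespace Literature.Analysis.PDE

open Literature.Analysis.FunctionSpaces Literature.Analysis.FluidPDE Literature.Analysis.Calculus

/-! ### Word derivatives: energies, sup bounds, commutation with the time derivative -/

section Words

variable {E' : Type*} [NormedAddCommGroup E'] [InnerProductSpace ℝ E'] [FiniteDimensional ℝ E']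
  [MeasurableSpace E'] [BorelSpace E']
variable {F' : Type*} [NormedAddCommGroup F'] [InnerProductSpace ℝ F']

/-- **Energies of frame-word derivatives**: `E_k(∂_β f) ≤ E_{k + |β|}(f)`. [folklore] -/
theorem sobolevEnergy_iterDirDeriv_le (f : E' → F') :
    ∀ (β : List (Fin (Module.finrank ℝ E'))) (k : ℕ),
      sobolevEnergy k (iterDirDeriv (β.map (stdOrthonormalBasis ℝ E')) f) ≤ sobolevEnergy (k + β.length) f
  | [], k => by simp [iterDirDeriv_nil]
  | i :: β, k => by
    have ih := sobolevEnergy_iterDirDeriv_le f β (k + 1)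
    rw [List.map_cons, iterDirDeriv_cons, List.length_cons]
    calc sobolevEnergy k (fun x ↦ fderiv ℝ (iterDirDeriv (β.map (stdOrthonormalBasis ℝ E')) f) x (stdOrthonormalBasis ℝ E' i))
        ≤ sobolevEnergy (k + 1) (iterDirDeriv (β.map (stdOrthonormalBasis ℝ E')) f) := by
          rw [sobolevEnergy_succ]
          refine le_trans ?_ le_add_self
          exact Finset.single_le_sum (f := fun j ↦ sobolevEnergy k fun x ↦
            fderiv ℝ (iterDirDeriv (β.map (stdOrthonormalBasis ℝ E')) f) x (stdOrthonormalBasis ℝ E' j))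
            (fun _ _ ↦ bot_le) (Finset.mem_univ i)
      _ ≤ sobolevEnergy (k + 1 + β.length) f := ih
      _ = sobolevEnergy (k + (β.length + 1)) f := by rw [show k + 1 + β.length = k + (β.length + 1) by omega]

variable [FiniteDimensional ℝ F']

/-- **Sup bound of frame-word derivatives by energies**: there is `C < ∞` (dimension only) with
`‖∂_β f(x)‖ₑ² ≤ C E_{2(n+1) + |β|}(f)` for every smooth compactly supported `f`, every frame word
`β` and every `x`. [cite: Evans2010, §5.6.3, Thm. 6] -/
theorem enorm_iterDirDeriv_sq_le :
    ∃ C : ℝ≥0∞, C ≠ ⊤ ∧ ∀ {f : E' → F'}, ContDiff ℝ ∞ f → HasCompactSupport f →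
      ∀ (β : List (Fin (Module.finrank ℝ E'))) (x : E'),
        ‖iterDirDeriv (β.map (stdOrthonormalBasis ℝ E')) f x‖ₑ ^ 2 ≤
          C * sobolevEnergy (2 * (Module.finrank ℝ E' + 1) + β.length) f := by
  obtain ⟨C, hCtop, hC⟩ := enorm_sq_le_sobolevEnergy (E := E') (F' := F')
  refine ⟨C, hCtop, fun {f} hf hfc β x ↦ ?_⟩
  have hadm : IsHeatAdmissible (iterDirDeriv (β.map (stdOrthonormalBasis ℝ E')) f) :=
    IsHeatAdmissible.of_hasCompactSupport (contDiff_iterDirDeriv hf _) (hasCompactSupport_iterDirDeriv hfc _)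
  exact (hC hadm x).trans (mul_le_mul' le_rfl (sobolevEnergy_iterDirDeriv_le f β _))

omit [FiniteDimensional ℝ E'] [MeasurableSpace E'] [BorelSpace E'] [FiniteDimensional ℝ F'] in
/-- **Word derivatives commute with the time derivative within `[0, T]`** for slab-smooth
fields. [folklore] -/
theorem timeDerivWithin_iterDirDeriv {T : ℝ} (hT : 0 < T) {w : ℝ → E' → F'} (hw : IsSmoothSpaceTimeOn (Icc 0 T) w) :
    ∀ (β : List E') {t : ℝ}, t ∈ Icc 0 T → ∀ x : E',
      timeDerivWithin (Icc 0 T) (fun s ↦ iterDirDeriv β (w s)) t x = iterDirDeriv β (timeDerivWithin (Icc 0 T) w t) x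
  | [], _, _, _ => rfl
  | v :: β, t, ht, x => by
    have hcl : Icc 0 T ⊆ closure (interior (Icc 0 T)) := by
      rw [interior_Icc, closure_Ioo hT.ne]
    have hwβ : IsSmoothSpaceTimeOn (Icc 0 T) fun s ↦ iterDirDeriv β (w s) := isSmoothSpaceTimeOn_iterDirDeriv_Icc hT hw β
    have h1 := hwβ.timeDerivWithin_fderiv_slice_apply (uniqueDiffOn_Icc hT) hcl ht x v
    have hfun : timeDerivWithin (Icc 0 T) (fun s ↦ iterDirDeriv β (w s)) t =
        iterDirDeriv β (timeDerivWithin (Icc 0 T) w t) := funext fun y ↦ timeDerivWithin_iterDirDeriv hT hw β ht y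
    simp only [iterDirDeriv_cons]
    rw [← hfun]
    exact h1

end Words

/-! ### Word derivatives of the frame operator applied to a small function -/

section FrameOpWords

variable {E' : Type*} [NormedAddCommGroup E'] [InnerProductSpace ℝ E'] [FiniteDimensional ℝ E']
variable {F' : Type*} [NormedAddCommGroup F'] [InnerProductSpace ℝ F']

omit [FiniteDimensional ℝ E'] in
/-- Iterated derivatives of `y ↦ c(y) (g y)` from bounds of those of `c` and `g`:
`‖Dᵐ(c g)(x)‖ ≤ 2ᵐ M_c M_g`. [folklore] -/
theorem norm_iteratedFDeriv_clm_apply_le_of_bounds {c : E' → (F' →L[ℝ] F')} {g : E' → F'} (hc : ContDiff ℝ ∞ c)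
    (hg : ContDiff ℝ ∞ g) (m : ℕ) (x : E') {Mc Mg : ℝ} (hMc0 : 0 ≤ Mc) (hMc : ∀ j ≤ m, ‖iteratedFDeriv ℝ j c x‖ ≤ Mc)
    (hMg : ∀ j ≤ m, ‖iteratedFDeriv ℝ j g x‖ ≤ Mg) :
    ‖iteratedFDeriv ℝ m (fun y ↦ c y (g y)) x‖ ≤ 2 ^ m * Mc * Mg := by
  have hMg0 : 0 ≤ Mg := (norm_nonneg _).trans (hMg 0 (Nat.zero_le _))
  refine (norm_iteratedFDeriv_clm_apply hc hg x (n := m) (by exact_mod_cast le_top)).trans ?_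
  calc ∑ i ∈ Finset.range (m + 1), (m.choose i : ℝ) * ‖iteratedFDeriv ℝ i c x‖ * ‖iteratedFDeriv ℝ (m - i) g x‖
      ≤ ∑ i ∈ Finset.range (m + 1), (m.choose i : ℝ) * Mc * Mg := by
        refine Finset.sum_le_sum fun i hi ↦ ?_
        have hi' : i ≤ m := Nat.lt_succ_iff.1 (Finset.mem_range.1 hi)
        exact mul_le_mul (mul_le_mul_of_nonneg_left (hMc i hi') (Nat.cast_nonneg _)) (hMg _ (Nat.sub_le _ _))
          (norm_nonneg _) (mul_nonneg (Nat.cast_nonneg _) hMc0)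
    _ = 2 ^ m * Mc * Mg := by
        rw [← Finset.sum_mul, ← Finset.sum_mul]
        congr 1; congr 1
        have h := (Nat.sum_range_choose m)
        exact_mod_cast h

/-- From uniform smallness of all frame words of length `≤ m + 2` to smallness of the iterated
derivatives up to order `m` of a second frame-word derivative. [folklore] -/
theorem norm_iteratedFDeriv_word_le_of_words {u : E' → F'} (hu : ContDiff ℝ ∞ u) {m : ℕ} {δ : ℝ} (hδ : 0 ≤ δ)
    (hsmall : ∀ w : List (Fin (Module.finrank ℝ E')), w.length ≤ m + 2 → ∀ y, ‖iterDirDeriv (w.map (stdOrthonormalBasis ℝ E')) u y‖ ≤ δ)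
    (α : List (Fin (Module.finrank ℝ E'))) (hα : α.length ≤ 2) (j : ℕ) (hj : j ≤ m) (y : E') :
    ‖iteratedFDeriv ℝ j (iterDirDeriv (α.map (stdOrthonormalBasis ℝ E')) u) y‖ ≤ (Module.finrank ℝ E' : ℝ) ^ j * δ := by
  refine norm_iteratedFDeriv_le_of_frame_words (contDiff_iterDirDeriv hu _) j y hδ fun v ↦ ?_
  have heq : (List.ofFn fun k ↦ stdOrthonormalBasis ℝ E' (v k)) = (List.ofFn v).map (stdOrthonormalBasis ℝ E') := by
    rw [List.map_ofFn]; rfl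
  rw [heq, ← iterDirDeriv_append, ← List.map_append]
  exact hsmall _ (by simp; omega) y

/-- **Word derivatives of the frame operator of a function with small frame words**: with
iterated derivatives of the coefficient slices up to order `m` bounded by `M_c ≥ 0`, and all frame
words of `u` of length `≤ m + 2` bounded by `δ` everywhere, for every word `β` of length `m`,
`‖∂_β (frameOp S 𝔟 𝔠 u)(x)‖ ≤ (n² 2ᵐ + n + 1) 4ᵐ M_c (n+1)ᵐ δ Π‖βᵢ‖`. [cite: Evans2010, §7.1.3] -/
theorem norm_iterDirDeriv_frameOp_le {S₀ : E' → (E' →L[ℝ] E')} {𝔟₀ : E' → ((E' →L[ℝ] F') →L[ℝ] F')} {𝔠₀ : E' → (F' →L[ℝ] F')}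
    (hS : ContDiff ℝ ∞ S₀) (h𝔟 : ContDiff ℝ ∞ 𝔟₀) (h𝔠 : ContDiff ℝ ∞ 𝔠₀) {m : ℕ} {Mc : ℝ} (hMc0 : 0 ≤ Mc)
    (hMS : ∀ j ≤ m, ∀ y, ‖iteratedFDeriv ℝ j S₀ y‖ ≤ Mc) (hMB : ∀ j ≤ m, ∀ y, ‖iteratedFDeriv ℝ j 𝔟₀ y‖ ≤ Mc)
    (hMC : ∀ j ≤ m, ∀ y, ‖iteratedFDeriv ℝ j 𝔠₀ y‖ ≤ Mc) {u : E' → F'} (hu : ContDiff ℝ ∞ u) {δ : ℝ} (hδ : 0 ≤ δ)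
    (hsmall : ∀ w : List (Fin (Module.finrank ℝ E')), w.length ≤ m + 2 → ∀ y, ‖iterDirDeriv (w.map (stdOrthonormalBasis ℝ E')) u y‖ ≤ δ)
    (β : List E') (hβ : β.length = m) (x : E') :
    ‖iterDirDeriv β (fun y ↦ frameOp (S₀ y) (𝔟₀ y) (𝔠₀ y) u y) x‖ ≤
      (((Module.finrank ℝ E' : ℝ) ^ 2 * 2 ^ m + Module.finrank ℝ E' + 1) * (2 ^ m * (2 ^ m * Mc) * (((Module.finrank ℝ E' : ℝ) + 1) ^ m * δ))) *
        ∏ i, ‖β.get i‖ := by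
  set n : ℕ := Module.finrank ℝ E' with hn
  set e := stdOrthonormalBasis ℝ E' with he
  set G : ℝ := ((n : ℝ) + 1) ^ m * δ with hG
  have hG0 : 0 ≤ G := by positivity
  have hGle : ∀ j ≤ m, (n : ℝ) ^ j * δ ≤ G := fun j hj ↦
    mul_le_mul_of_nonneg_right ((pow_le_pow_left₀ (Nat.cast_nonneg _) (by linarith) j).trans
      (pow_le_pow_right₀ (by linarith) hj)) hδ
  -- the decomposition of the frame operator
  set Q : Fin n → (F' →L[ℝ] (E' →L[ℝ] F')) := fun l ↦ ContinuousLinearMap.smulRightL ℝ E' F' (innerSL ℝ (e l)) with hQ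
  have hQn : ∀ l, ‖Q l‖ ≤ 1 := fun l ↦ norm_smulRightL_innerSL_le' l
  have hdec : (fun y ↦ frameOp (S₀ y) (𝔟₀ y) (𝔠₀ y) u y) = fun y ↦
      (∑ k, ∑ l, (⟪e k, S₀ y (e l)⟫ • ContinuousLinearMap.id ℝ F') (iterDirDeriv ([k, l].map e) u y)) +
      (∑ l, (𝔟₀ y ∘L Q l) (iterDirDeriv ([l].map e) u y)) + 𝔠₀ y (iterDirDeriv ([] : List E') u y) := by
    funext y
    rw [frameOp_apply, principalPart_apply, ParabolicTower.clm_fderiv_eq_sum]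
    simp only [List.map_cons, List.map_nil, FunLike.coe_smul, Pi.smul_apply, ContinuousLinearMap.id_apply, iterDirDeriv_cons,
      iterDirDeriv_nil, he, hQ]
    rfl
  -- smoothness of the pieces
  have hg2 : ∀ k l : Fin n, ContDiff ℝ ∞ (iterDirDeriv ([k, l].map e) u) := fun k l ↦ contDiff_iterDirDeriv hu _
  have hg1 : ∀ l : Fin n, ContDiff ℝ ∞ (iterDirDeriv ([l].map e) u) := fun l ↦ contDiff_iterDirDeriv hu _
  have hm_s : ∀ k l : Fin n, ContDiff ℝ ∞ fun y ↦ ⟪e k, S₀ y (e l)⟫ • ContinuousLinearMap.id ℝ F' := fun k l ↦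
    (contDiff_const.inner ℝ (hS.clm_apply contDiff_const)).smul contDiff_const
  have hB_s : ∀ l : Fin n, ContDiff ℝ ∞ fun y ↦ 𝔟₀ y ∘L Q l := fun l ↦ h𝔟.clm_comp contDiff_const
  -- bounds of the coefficient pieces
  have hm_b : ∀ k l : Fin n, ∀ j ≤ m, ∀ y, ‖iteratedFDeriv ℝ j (fun y ↦ ⟪e k, S₀ y (e l)⟫ • ContinuousLinearMap.id ℝ F') y‖ ≤ 2 ^ m * Mc := by
    intro k l j hj y
    have h1 : ∀ i ≤ j, ‖iteratedFDeriv ℝ i (fun y ↦ ⟪e k, S₀ y (e l)⟫) y‖ ≤ Mc := fun i hi ↦ by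
      refine (norm_iteratedFDeriv_inner_apply_le hS (e k) (e l) i y).trans ?_
      rw [he, (stdOrthonormalBasis ℝ E').orthonormal.1 k, (stdOrthonormalBasis ℝ E').orthonormal.1 l, one_mul, one_mul]
      exact hMS i (hi.trans hj) y
    have h2 : ∀ i ≤ j, ‖iteratedFDeriv ℝ i (fun _ : E' ↦ ContinuousLinearMap.id ℝ F') y‖ ≤ 1 := by
      intro i _
      rcases Nat.eq_zero_or_pos i with rfl | hi
      · rw [norm_iteratedFDeriv_zero]; exact ContinuousLinearMap.norm_id_le
      · rw [iteratedFDeriv_const_of_ne hi.ne']; simp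
    calc _ ≤ 2 ^ j * Mc * 1 := norm_iteratedFDeriv_smul_le_of_bounds (contDiff_const.inner ℝ (hS.clm_apply contDiff_const))
          contDiff_const j y hMc0 h1 h2
      _ ≤ 2 ^ m * Mc := by rw [mul_one]; gcongr; norm_num
  have hB_b : ∀ l : Fin n, ∀ j ≤ m, ∀ y, ‖iteratedFDeriv ℝ j (fun y ↦ 𝔟₀ y ∘L Q l) y‖ ≤ 2 ^ m * Mc := by
    intro l j hj y
    refine (norm_iteratedFDeriv_precomp_le h𝔟 (Q l) j y).trans ?_
    calc ‖Q l‖ * ‖iteratedFDeriv ℝ j 𝔟₀ y‖ ≤ 1 * Mc := mul_le_mul (hQn l) (hMB j hj y) (norm_nonneg _) zero_le_one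
      _ ≤ 2 ^ m * Mc := by rw [one_mul]; exact le_mul_of_one_le_left hMc0 (one_le_pow₀ (by norm_num))
  have hC_b : ∀ j ≤ m, ∀ y, ‖iteratedFDeriv ℝ j 𝔠₀ y‖ ≤ 2 ^ m * Mc := fun j hj y ↦
    (hMC j hj y).trans (le_mul_of_one_le_left hMc0 (one_le_pow₀ (by norm_num)))
  -- bounds of the jet pieces
  have hj2 : ∀ k l : Fin n, ∀ j ≤ m, ∀ y, ‖iteratedFDeriv ℝ j (iterDirDeriv ([k, l].map e) u) y‖ ≤ G := fun k l j hj y ↦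
    (norm_iteratedFDeriv_word_le_of_words hu hδ hsmall [k, l] (by simp) j hj y).trans (hGle j hj)
  have hj1 : ∀ l : Fin n, ∀ j ≤ m, ∀ y, ‖iteratedFDeriv ℝ j (iterDirDeriv ([l].map e) u) y‖ ≤ G := fun l j hj y ↦
    (norm_iteratedFDeriv_word_le_of_words hu hδ hsmall [l] (by simp) j hj y).trans (hGle j hj)
  have hj0 : ∀ j ≤ m, ∀ y, ‖iteratedFDeriv ℝ j (iterDirDeriv ([] : List E') u) y‖ ≤ G := fun j hj y ↦ by
    have h := (norm_iteratedFDeriv_word_le_of_words hu hδ hsmall [] (by simp) j hj y).trans (hGle j hj)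
    simpa using h
  -- the iterated derivative of the frame operator at `x`
  have h2m : (0 : ℝ) ≤ 2 ^ m * Mc := by positivity
  have hterm2 : ∀ k l : Fin n, ‖iteratedFDeriv ℝ m (fun y ↦ (⟪e k, S₀ y (e l)⟫ • ContinuousLinearMap.id ℝ F')
      (iterDirDeriv ([k, l].map e) u y)) x‖ ≤ 2 ^ m * (2 ^ m * Mc) * G := fun k l ↦
    norm_iteratedFDeriv_clm_apply_le_of_bounds (hm_s k l) (hg2 k l) m x h2m (fun j hj ↦ hm_b k l j hj x) (fun j hj ↦ hj2 k l j hj x)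
  have hterm1 : ∀ l : Fin n, ‖iteratedFDeriv ℝ m (fun y ↦ (𝔟₀ y ∘L Q l) (iterDirDeriv ([l].map e) u y)) x‖ ≤
      2 ^ m * (2 ^ m * Mc) * G := fun l ↦
    norm_iteratedFDeriv_clm_apply_le_of_bounds (hB_s l) (hg1 l) m x h2m (fun j hj ↦ hB_b l j hj x) (fun j hj ↦ hj1 l j hj x)
  have hterm0 : ‖iteratedFDeriv ℝ m (fun y ↦ 𝔠₀ y (iterDirDeriv ([] : List E') u y)) x‖ ≤ 2 ^ m * (2 ^ m * Mc) * G :=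
    norm_iteratedFDeriv_clm_apply_le_of_bounds h𝔠 (contDiff_iterDirDeriv hu _) m x h2m (fun j hj ↦ hC_b j hj x) (fun j hj ↦ hj0 j hj x)
  -- sums
  have hle : ∀ {f : E' → F'}, ContDiff ℝ ∞ f → ContDiff ℝ m f := fun hf ↦ hf.of_le (by exact_mod_cast le_top)
  have hsumP : ‖iteratedFDeriv ℝ m (fun y ↦ ∑ k, ∑ l, (⟪e k, S₀ y (e l)⟫ • ContinuousLinearMap.id ℝ F')
      (iterDirDeriv ([k, l].map e) u y)) x‖ ≤ (n : ℝ) ^ 2 * (2 ^ m * (2 ^ m * Mc) * G) := by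
    have hs : ∀ k : Fin n, ContDiff ℝ m fun y ↦ ∑ l, (⟪e k, S₀ y (e l)⟫ • ContinuousLinearMap.id ℝ F') (iterDirDeriv ([k, l].map e) u y) :=
      fun k ↦ ContDiff.sum fun l _ ↦ hle ((hm_s k l).clm_apply (hg2 k l))
    rw [iteratedFDeriv_sum (fun k _ ↦ hs k), Finset.sum_apply]
    refine (norm_sum_le _ _).trans ?_
    calc ∑ k, ‖iteratedFDeriv ℝ m (fun y ↦ ∑ l, (⟪e k, S₀ y (e l)⟫ • ContinuousLinearMap.id ℝ F') (iterDirDeriv ([k, l].map e) u y)) x‖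
        ≤ ∑ _k : Fin n, (n : ℝ) * (2 ^ m * (2 ^ m * Mc) * G) := by
          refine Finset.sum_le_sum fun k _ ↦ ?_
          rw [iteratedFDeriv_sum (fun l _ ↦ hle ((hm_s k l).clm_apply (hg2 k l))), Finset.sum_apply]
          refine (norm_sum_le _ _).trans ?_
          calc _ ≤ ∑ _l : Fin n, 2 ^ m * (2 ^ m * Mc) * G := Finset.sum_le_sum fun l _ ↦ hterm2 k l
            _ = (n : ℝ) * (2 ^ m * (2 ^ m * Mc) * G) := by rw [Finset.sum_const, Finset.card_univ, Fintype.card_fin, nsmul_eq_mul]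
      _ = (n : ℝ) ^ 2 * (2 ^ m * (2 ^ m * Mc) * G) := by rw [Finset.sum_const, Finset.card_univ, Fintype.card_fin, nsmul_eq_mul]; ring
  have hsumB : ‖iteratedFDeriv ℝ m (fun y ↦ ∑ l, (𝔟₀ y ∘L Q l) (iterDirDeriv ([l].map e) u y)) x‖ ≤ (n : ℝ) * (2 ^ m * (2 ^ m * Mc) * G) := by
    rw [iteratedFDeriv_sum (fun l _ ↦ hle ((hB_s l).clm_apply (hg1 l))), Finset.sum_apply]
    refine (norm_sum_le _ _).trans ?_
    calc _ ≤ ∑ _l : Fin n, 2 ^ m * (2 ^ m * Mc) * G := Finset.sum_le_sum fun l _ ↦ hterm1 l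
      _ = (n : ℝ) * (2 ^ m * (2 ^ m * Mc) * G) := by rw [Finset.sum_const, Finset.card_univ, Fintype.card_fin, nsmul_eq_mul]
  have hall : ‖iteratedFDeriv ℝ m (fun y ↦ frameOp (S₀ y) (𝔟₀ y) (𝔠₀ y) u y) x‖ ≤
      ((n : ℝ) ^ 2 * 2 ^ m + n + 1) * (2 ^ m * (2 ^ m * Mc) * G) := by
    rw [hdec]
    have hfP : ContDiff ℝ m fun y ↦ ∑ k, ∑ l, (⟪e k, S₀ y (e l)⟫ • ContinuousLinearMap.id ℝ F') (iterDirDeriv ([k, l].map e) u y) :=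
      ContDiff.sum fun k _ ↦ ContDiff.sum fun l _ ↦ hle ((hm_s k l).clm_apply (hg2 k l))
    have hfB : ContDiff ℝ m fun y ↦ ∑ l, (𝔟₀ y ∘L Q l) (iterDirDeriv ([l].map e) u y) :=
      ContDiff.sum fun l _ ↦ hle ((hB_s l).clm_apply (hg1 l))
    have hfC : ContDiff ℝ m fun y ↦ 𝔠₀ y (iterDirDeriv ([] : List E') u y) := hle (h𝔠.clm_apply (contDiff_iterDirDeriv hu _))
    rw [fun_iteratedFDeriv_add_apply (hfP.add hfB).contDiffAt hfC.contDiffAt, fun_iteratedFDeriv_add_apply hfP.contDiffAt hfB.contDiffAt]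
    refine (norm_add_le _ _).trans (add_le_add ((norm_add_le _ _).trans (add_le_add hsumP hsumB)) hterm0) |>.trans ?_
    have hX : 0 ≤ 2 ^ m * (2 ^ m * Mc) * G := by positivity
    have h2 : (1 : ℝ) ≤ 2 ^ m := one_le_pow₀ (by norm_num)
    calc (n : ℝ) ^ 2 * (2 ^ m * (2 ^ m * Mc) * G) + n * (2 ^ m * (2 ^ m * Mc) * G) + 2 ^ m * (2 ^ m * Mc) * G
        ≤ (n : ℝ) ^ 2 * 2 ^ m * (2 ^ m * (2 ^ m * Mc) * G) + n * (2 ^ m * (2 ^ m * Mc) * G) + 2 ^ m * (2 ^ m * Mc) * G := by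
          gcongr
          exact le_mul_of_one_le_right (sq_nonneg _) h2
      _ = _ := by ring
  -- to the word
  calc ‖iterDirDeriv β (fun y ↦ frameOp (S₀ y) (𝔟₀ y) (𝔠₀ y) u y) x‖
      ≤ ‖iteratedFDeriv ℝ β.length (fun y ↦ frameOp (S₀ y) (𝔟₀ y) (𝔠₀ y) u y) x‖ * ∏ i, ‖β.get i‖ :=
        norm_iterDirDeriv_le (by rw [hdec]; exact ((ContDiff.sum fun k _ ↦ ContDiff.sum fun l _ ↦ (hm_s k l).clm_apply (hg2 k l)).add
          (ContDiff.sum fun l _ ↦ (hB_s l).clm_apply (hg1 l))).add (h𝔠.clm_apply (contDiff_iterDirDeriv hu _))) β x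
    _ ≤ _ := by
        have hlen : ‖iteratedFDeriv ℝ β.length (fun y ↦ frameOp (S₀ y) (𝔟₀ y) (𝔠₀ y) u y) x‖ ≤
            ((n : ℝ) ^ 2 * 2 ^ m + n + 1) * (2 ^ m * (2 ^ m * Mc) * G) := by rw [hβ]; exact hall
        exact mul_le_mul_of_nonneg_right hlen (Finset.prod_nonneg fun i _ ↦ norm_nonneg _)

end FrameOpWords

/-! ### Limits of slab families whose frame-word derivatives are uniformly Cauchy -/

section Limit

variable {E' : Type*} [NormedAddCommGroup E'] [InnerProductSpace ℝ E'] [FiniteDimensional ℝ E']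
variable {F' : Type*} [NormedAddCommGroup F'] [InnerProductSpace ℝ F'] [FiniteDimensional ℝ F']

omit [FiniteDimensional ℝ E'] [FiniteDimensional ℝ F'] in
/-- Word derivatives are linear: `∂_β (f - g) = ∂_β f - ∂_β g` for smooth `f, g`. [folklore] -/
theorem iterDirDeriv_sub_apply {f g : E' → F'} (hf : ContDiff ℝ ∞ f) (hg : ContDiff ℝ ∞ g) (β : List E') (x : E') :
    iterDirDeriv β (fun y ↦ f y - g y) x = iterDirDeriv β f x - iterDirDeriv β g x := by
  have h1 : (fun y ↦ f y - g y) = f + fun y ↦ (-1 : ℝ) • g y := by funext y; simp [sub_eq_add_neg]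
  rw [h1, iterDirDeriv_add hf (hg.const_smul _), Pi.add_apply, iterDirDeriv_const_smul hg]
  simp [sub_eq_add_neg]

omit [FiniteDimensional ℝ F'] in
/-- **General words from frame words**: if all frame words of length `m` of a smooth `u` are bounded
by `δ` at `y`, then `‖∂_β u(y)‖ ≤ nᵐ δ Π‖βᵢ‖` for every word `β` of length `m`. [folklore] -/
theorem norm_iterDirDeriv_le_of_frame_words {u : E' → F'} (hu : ContDiff ℝ ∞ u) (β : List E') (y : E') {δ : ℝ} (hδ : 0 ≤ δ)
    (h : ∀ w : List (Fin (Module.finrank ℝ E')), w.length = β.length → ‖iterDirDeriv (w.map (stdOrthonormalBasis ℝ E')) u y‖ ≤ δ) :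
    ‖iterDirDeriv β u y‖ ≤ (Module.finrank ℝ E' : ℝ) ^ β.length * δ * ∏ i, ‖β.get i‖ := by
  refine (norm_iterDirDeriv_le hu β y).trans (mul_le_mul_of_nonneg_right ?_ (Finset.prod_nonneg fun i _ ↦ norm_nonneg _))
  refine norm_iteratedFDeriv_le_of_frame_words hu _ y hδ fun v ↦ ?_
  have heq : (List.ofFn fun k ↦ stdOrthonormalBasis ℝ E' (v k)) = (List.ofFn v).map (stdOrthonormalBasis ℝ E') := by
    rw [List.map_ofFn]; rfl
  rw [heq]
  exact h _ (by simp)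

/-- **Limits of slab families with uniformly Cauchy frame-word derivatives.** Let `f N` be
slab-smooth on `[0, T]` and suppose that for every `m` and `ε > 0`, eventually in `N, N'`, all
frame-word derivatives of length `≤ m` of `f N t - f N' t` are `≤ ε` on the whole slab. Then there
is `F` with smooth slices on `[0, T]`, to whose word derivatives those of the `f N` converge
uniformly on the slab, all of whose word derivatives are jointly continuous on the slab.
[cite: Evans2010, §7.1.2, Thm. 3] -/
theorem exists_slab_limit_of_words_cauchy {T : ℝ} (hT : 0 < T) {f : ℕ → ℝ → E' → F'}
    (hf : ∀ N, IsSmoothSpaceTimeOn (Icc 0 T) (f N))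
    (hC : ∀ (m : ℕ) (ε : ℝ), 0 < ε → ∃ N₀ : ℕ, ∀ N ≥ N₀, ∀ N' ≥ N₀, ∀ w : List (Fin (Module.finrank ℝ E')), w.length ≤ m →
      ∀ t ∈ Icc 0 T, ∀ y, ‖iterDirDeriv (w.map (stdOrthonormalBasis ℝ E')) (f N t) y -
        iterDirDeriv (w.map (stdOrthonormalBasis ℝ E')) (f N' t) y‖ ≤ ε) :
    ∃ F : ℝ → E' → F',
      (∀ t ∈ Icc 0 T, ContDiff ℝ ∞ (F t)) ∧
      (∀ β : List E', TendstoUniformlyOn (fun N (q : ℝ × E') ↦ iterDirDeriv β (f N q.1) q.2)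
        (fun q ↦ iterDirDeriv β (F q.1) q.2) atTop (Icc 0 T ×ˢ univ)) ∧
      (∀ β : List E', ContinuousOn (fun q : ℝ × E' ↦ iterDirDeriv β (F q.1) q.2) (Icc 0 T ×ˢ univ)) ∧
      (∀ t ∈ Icc 0 T, ∀ y, Tendsto (fun N ↦ f N t y) atTop (𝓝 (F t y))) := by
  haveI : CompleteSpace F' := FiniteDimensional.complete ℝ F'
  set n : ℕ := Module.finrank ℝ E' with hn
  have hfs : ∀ N, ∀ t ∈ Icc 0 T, ContDiff ℝ ∞ (f N t) := fun N t ht ↦ (hf N).contDiff_slice ht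
  -- Step A: uniform Cauchy property of every word derivative on the slab
  have hA : ∀ β : List E', UniformCauchySeqOn (fun N (q : ℝ × E') ↦ iterDirDeriv β (f N q.1) q.2) atTop (Icc 0 T ×ˢ univ) := by
    intro β
    rw [Metric.uniformCauchySeqOn_iff]
    intro ε hε
    set Pb : ℝ := ∏ i, ‖β.get i‖ with hPb
    have hPb0 : 0 ≤ Pb := Finset.prod_nonneg fun i _ ↦ norm_nonneg _
    have hpos : 0 < ((n : ℝ) ^ β.length + 1) * (Pb + 1) := by positivity
    obtain ⟨N₀, hN₀⟩ := hC β.length (ε / (2 * (((n : ℝ) ^ β.length + 1) * (Pb + 1)))) (by positivity)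
    refine ⟨N₀, fun N hN N' hN' q hq ↦ ?_⟩
    have ht : q.1 ∈ Icc 0 T := (mem_prod.1 hq).1
    rw [dist_eq_norm, ← iterDirDeriv_sub_apply (hfs N q.1 ht) (hfs N' q.1 ht)]
    have hδ0 : 0 ≤ ε / (2 * (((n : ℝ) ^ β.length + 1) * (Pb + 1))) := by positivity
    have h := norm_iterDirDeriv_le_of_frame_words ((hfs N q.1 ht).sub (hfs N' q.1 ht)) β q.2 hδ0 fun w hw ↦ by
      rw [iterDirDeriv_sub_apply (hfs N q.1 ht) (hfs N' q.1 ht)]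
      exact hN₀ N hN N' hN' w hw.le q.1 ht q.2
    refine h.trans_lt ?_
    calc (n : ℝ) ^ β.length * (ε / (2 * (((n : ℝ) ^ β.length + 1) * (Pb + 1)))) * Pb
        ≤ ((n : ℝ) ^ β.length + 1) * (ε / (2 * (((n : ℝ) ^ β.length + 1) * (Pb + 1)))) * (Pb + 1) := by gcongr <;> linarith
      _ = ε / 2 := by field_simp
      _ < ε := by linarith
  -- Step B: pointwise limits on the slab
  have hlim : ∀ (β : List E') (q : ℝ × E'), q ∈ Icc 0 T ×ˢ (univ : Set E') →
      ∃ z, Tendsto (fun N ↦ iterDirDeriv β (f N q.1) q.2) atTop (𝓝 z) := fun β q hq ↦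
    cauchySeq_tendsto_of_complete ((hA β).cauchySeq hq)
  choose! g hg using hlim
  have hgu : ∀ β, TendstoUniformlyOn (fun N (q : ℝ × E') ↦ iterDirDeriv β (f N q.1) q.2) (g β) atTop (Icc 0 T ×ˢ univ) :=
    fun β ↦ (hA β).tendstoUniformlyOn_of_tendsto fun q hq ↦ hg β q hq
  set F : ℝ → E' → F' := fun t y ↦ g [] (t, y) with hF
  have hFlim : ∀ t ∈ Icc 0 T, ∀ y, Tendsto (fun N ↦ f N t y) atTop (𝓝 (F t y)) := fun t ht y ↦
    hg [] (t, y) (mk_mem_prod ht (mem_univ y))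
  -- Step C: slices of the limit are smooth, with the limits as iterated derivatives
  have hiter : ∀ t ∈ Icc 0 T, ∀ k, UniformCauchySeqOn (fun N ↦ iteratedFDeriv ℝ k (f N t)) atTop univ := by
    intro t ht k
    rw [Metric.uniformCauchySeqOn_iff]
    intro ε hε
    obtain ⟨N₀, hN₀⟩ := hC k (ε / (2 * ((n : ℝ) ^ k + 1))) (by positivity)
    refine ⟨N₀, fun N hN N' hN' y _ ↦ ?_⟩
    have hsub : ContDiff ℝ ∞ (f N t - f N' t) := (hfs N t ht).sub (hfs N' t ht)
    rw [dist_eq_norm, ← iteratedFDeriv_sub_apply ((hfs N t ht).contDiffAt.of_le (by exact_mod_cast le_top))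
      ((hfs N' t ht).contDiffAt.of_le (by exact_mod_cast le_top))]
    have hδ0 : 0 ≤ ε / (2 * ((n : ℝ) ^ k + 1)) := by positivity
    have h := norm_iteratedFDeriv_le_of_frame_words hsub k y hδ0 fun v ↦ by
      have heq : (List.ofFn fun j ↦ stdOrthonormalBasis ℝ E' (v j)) = (List.ofFn v).map (stdOrthonormalBasis ℝ E') := by
        rw [List.map_ofFn]; rfl
      rw [heq, show f N t - f N' t = fun y ↦ f N t y - f N' t y from rfl, iterDirDeriv_sub_apply (hfs N t ht) (hfs N' t ht)]
      exact hN₀ N hN N' hN' _ (by simp) t ht y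
    refine h.trans_lt ?_
    have hpos : 0 < (n : ℝ) ^ k + 1 := by positivity
    calc (n : ℝ) ^ k * (ε / (2 * ((n : ℝ) ^ k + 1))) ≤ ((n : ℝ) ^ k + 1) * (ε / (2 * ((n : ℝ) ^ k + 1))) := by gcongr; linarith
      _ = ε / 2 := by field_simp
      _ < ε := by linarith
  have hGk : ∀ t ∈ Icc 0 T, ∀ k, ∃ G : E' → ContinuousMultilinearMap ℝ (fun _ : Fin k ↦ E') F',
      TendstoUniformly (fun N ↦ iteratedFDeriv ℝ k (f N t)) G atTop := by
    intro t ht k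
    have hl : ∀ y ∈ (univ : Set E'), ∃ z, Tendsto (fun N ↦ iteratedFDeriv ℝ k (f N t) y) atTop (𝓝 z) := fun y hy ↦
      cauchySeq_tendsto_of_complete ((hiter t ht k).cauchySeq hy)
    choose! G hG using hl
    refine ⟨G, ?_⟩
    rw [← tendstoUniformlyOn_univ]
    exact (hiter t ht k).tendstoUniformlyOn_of_tendsto hG
  have hslice : ∀ t ∈ Icc 0 T, ContDiff ℝ ∞ (F t) ∧ ∀ k, ∃ G : E' → ContinuousMultilinearMap ℝ (fun _ : Fin k ↦ E') F',
      TendstoUniformly (fun N ↦ iteratedFDeriv ℝ k (f N t)) G atTop ∧ iteratedFDeriv ℝ k (F t) = G := by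
    intro t ht
    choose G hG using hGk t ht
    obtain ⟨hFs, hFG⟩ := contDiff_of_tendstoUniformly_iteratedFDeriv (fun N ↦ hfs N t ht) hG (hFlim t ht)
    exact ⟨hFs, fun k ↦ ⟨G k, hG k, hFG k⟩⟩
  have hFs : ∀ t ∈ Icc 0 T, ContDiff ℝ ∞ (F t) := fun t ht ↦ (hslice t ht).1
  -- Step D: the word derivatives of the limit are the limits of the word derivatives
  have hD : ∀ (β : List E'), ∀ t ∈ Icc 0 T, ∀ y, iterDirDeriv β (F t) y = g β (t, y) := by
    intro β t ht y
    obtain ⟨G, hG, hFG⟩ := (hslice t ht).2 β.length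
    have h1 : iterDirDeriv β (F t) y = G y (fun i ↦ β.get i) := by
      rw [iterDirDeriv_eq_iteratedFDeriv (hFs t ht), hFG]
    have h2 : Tendsto (fun N ↦ iterDirDeriv β (f N t) y) atTop (𝓝 (G y fun i ↦ β.get i)) := by
      have h3 : Tendsto (fun N ↦ iteratedFDeriv ℝ β.length (f N t) y) atTop (𝓝 (G y)) := hG.tendsto_at y
      have h4 := ((ContinuousMultilinearMap.apply ℝ (fun _ : Fin β.length ↦ E') F' fun i ↦ β.get i).continuous.tendsto _).comp h3
      refine h4.congr fun N ↦ ?_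
      simp only [Function.comp_apply, ContinuousMultilinearMap.apply_apply]
      rw [iterDirDeriv_eq_iteratedFDeriv (hfs N t ht)]
    rw [h1]
    exact tendsto_nhds_unique h2 (hg β (t, y) (mk_mem_prod ht (mem_univ y)))
  -- Step E: uniform convergence to the word derivatives of the limit; Step F: continuity
  have hE : ∀ β : List E', TendstoUniformlyOn (fun N (q : ℝ × E') ↦ iterDirDeriv β (f N q.1) q.2)
      (fun q ↦ iterDirDeriv β (F q.1) q.2) atTop (Icc 0 T ×ˢ univ) := fun β ↦
    (hgu β).congr_right fun q hq ↦ (hD β q.1 (mem_prod.1 hq).1 q.2).symm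
  have hcont : ∀ β : List E', ContinuousOn (fun q : ℝ × E' ↦ iterDirDeriv β (F q.1) q.2) (Icc 0 T ×ˢ univ) := fun β ↦
    (hE β).continuousOn (Eventually.of_forall fun N ↦ by
      have h := (isSmoothSpaceTimeOn_iterDirDeriv_Icc hT (hf N) β).continuousOn
      exact h).frequently
  exact ⟨F, hFs, hE, hcont, hFlim⟩

omit [FiniteDimensional ℝ E'] in
/-- `‖z‖ₑ² ≤ ε²` (as `ofReal`) gives `‖z‖ ≤ ε`. [folklore] -/
theorem norm_le_of_enorm_sq_le {G : Type*} [NormedAddCommGroup G] {z : G} {ε : ℝ} (hε : 0 ≤ ε)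
    (h : ‖z‖ₑ ^ 2 ≤ ENNReal.ofReal (ε ^ 2)) : ‖z‖ ≤ ε := by
  have h1 : ENNReal.ofReal (‖z‖ ^ 2) ≤ ENNReal.ofReal (ε ^ 2) := by
    rwa [← ofReal_norm, ← ENNReal.ofReal_pow (norm_nonneg _)] at h
  have h2 : ‖z‖ ^ 2 ≤ ε ^ 2 := (ENNReal.ofReal_le_ofReal_iff (by positivity)).1 h1
  exact (pow_le_pow_iff_left₀ (norm_nonneg _) hε two_ne_zero).1 h2

/-- Eventual smallness of `C · 4 · 2^{-N}` below `ε²`. [folklore] -/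
theorem exists_const_mul_inv_two_pow_le {C : ℝ≥0∞} (hC : C ≠ ⊤) {ε : ℝ} (hε : 0 < ε) :
    ∃ N₀ : ℕ, ∀ N ≥ N₀, C * ENNReal.ofReal (4 * 2⁻¹ ^ N) ≤ ENNReal.ofReal (ε ^ 2) := by
  have hex : ∀ {G : ℝ≥0∞}, G ≠ ⊤ → ∀ {ε' : ℝ}, 0 < ε' → ∃ N : ℕ, (2⁻¹ : ℝ≥0∞) ^ N * G ≤ ENNReal.ofReal ε' := by
    intro G hG ε' hε'
    rcases eq_or_ne G 0 with hG0 | hG0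
    · exact ⟨0, by simp [hG0]⟩
    have hpos : ENNReal.ofReal ε' / G ≠ 0 := (ENNReal.div_pos (by simpa using hε') hG).ne'
    obtain ⟨N, hN⟩ := ENNReal.exists_inv_two_pow_lt hpos
    exact ⟨N, ((ENNReal.lt_div_iff_mul_lt (Or.inl hG0) (Or.inl hG)).1 hN).le⟩
  obtain ⟨N₀, hN₀⟩ := hex (G := 4 * C) (ENNReal.mul_ne_top (by norm_num) hC) (pow_pos hε 2)
  refine ⟨N₀, fun N hN ↦ le_trans ?_ hN₀⟩
  rw [ENNReal.ofReal_mul (by norm_num), ENNReal.ofReal_pow (by norm_num), ENNReal.ofReal_inv_of_pos two_pos, ENNReal.ofReal_ofNat,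
    ENNReal.ofReal_ofNat]
  calc C * (4 * 2⁻¹ ^ N) = 2⁻¹ ^ N * (4 * C) := by ring
    _ ≤ 2⁻¹ ^ N₀ * (4 * C) := mul_le_mul' (pow_le_pow_right_of_le_one' (by norm_num) hN) le_rfl

end Limit

/-! ### Passage to the limit in the equation, word by word -/

section Passage

variable {E' : Type*} [NormedAddCommGroup E'] [InnerProductSpace ℝ E'] [FiniteDimensional ℝ E']
variable {F' : Type*} [NormedAddCommGroup F'] [InnerProductSpace ℝ F']

/-- The frame operator is subtractive in smooth functions. [folklore] -/
theorem frameOp_sub_fun (S₀ : E' →L[ℝ] E') (𝔟₀ : (E' →L[ℝ] F') →L[ℝ] F') (𝔠₀ : F' →L[ℝ] F') {u u' : E' → F'} (hu : ContDiff ℝ ∞ u)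
    (hu' : ContDiff ℝ ∞ u') (y : E') :
    frameOp S₀ 𝔟₀ 𝔠₀ (fun z ↦ u z - u' z) y = frameOp S₀ 𝔟₀ 𝔠₀ u y - frameOp S₀ 𝔟₀ 𝔠₀ u' y := by
  have hd : ∀ z, DifferentiableAt ℝ u z := fun z ↦ (hu.differentiable (by simp)) z
  have hd' : ∀ z, DifferentiableAt ℝ u' z := fun z ↦ (hu'.differentiable (by simp)) z
  have hD : fderiv ℝ (fun z ↦ u z - u' z) = fun z ↦ fderiv ℝ u z - fderiv ℝ u' z := funext fun z ↦ fderiv_fun_sub (hd z) (hd' z)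
  have h1 : ∀ v, ContDiff ℝ ∞ fun z ↦ fderiv ℝ u z v := fun v ↦ (hu.fderiv_right (m := ∞) (by norm_cast)).clm_apply contDiff_const
  have h1' : ∀ v, ContDiff ℝ ∞ fun z ↦ fderiv ℝ u' z v := fun v ↦ (hu'.fderiv_right (m := ∞) (by norm_cast)).clm_apply contDiff_const
  rw [frameOp_apply, frameOp_apply, frameOp_apply, principalPart_apply, principalPart_apply, principalPart_apply, hD]
  simp only [FunLike.coe_sub, Pi.sub_apply, map_sub]
  have h2 : ∀ k l, fderiv ℝ (fun z ↦ fderiv ℝ u z (stdOrthonormalBasis ℝ E' l) - fderiv ℝ u' z (stdOrthonormalBasis ℝ E' l)) y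
      (stdOrthonormalBasis ℝ E' k) = fderiv ℝ (fun z ↦ fderiv ℝ u z (stdOrthonormalBasis ℝ E' l)) y (stdOrthonormalBasis ℝ E' k) -
        fderiv ℝ (fun z ↦ fderiv ℝ u' z (stdOrthonormalBasis ℝ E' l)) y (stdOrthonormalBasis ℝ E' k) := by
    intro k l
    rw [fderiv_fun_sub (((h1 _).differentiable (by simp)) y) (((h1' _).differentiable (by simp)) y)]
    rfl
  simp only [h2, smul_sub, Finset.sum_sub_distrib]
  abel

/-- The frame operator of a smooth function with smooth coefficient slices is smooth. [folklore] -/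
theorem contDiff_frameOp_slice {S₀ : E' → (E' →L[ℝ] E')} {𝔟₀ : E' → ((E' →L[ℝ] F') →L[ℝ] F')} {𝔠₀ : E' → (F' →L[ℝ] F')}
    (hS : ContDiff ℝ ∞ S₀) (h𝔟 : ContDiff ℝ ∞ 𝔟₀) (h𝔠 : ContDiff ℝ ∞ 𝔠₀) {u : E' → F'} (hu : ContDiff ℝ ∞ u) :
    ContDiff ℝ ∞ fun y ↦ frameOp (S₀ y) (𝔟₀ y) (𝔠₀ y) u y := by
  have h1 : ∀ v, ContDiff ℝ ∞ fun z ↦ fderiv ℝ u z v := fun v ↦ (hu.fderiv_right (m := ∞) (by norm_cast)).clm_apply contDiff_const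
  have h2 : ∀ v w, ContDiff ℝ ∞ fun y ↦ fderiv ℝ (fun z ↦ fderiv ℝ u z v) y w := fun v w ↦
    ((h1 v).fderiv_right (m := ∞) (by norm_cast)).clm_apply contDiff_const
  have heq : (fun y ↦ frameOp (S₀ y) (𝔟₀ y) (𝔠₀ y) u y) = fun y ↦
      (∑ k, ∑ l, ⟪stdOrthonormalBasis ℝ E' k, S₀ y (stdOrthonormalBasis ℝ E' l)⟫ •
        fderiv ℝ (fun z ↦ fderiv ℝ u z (stdOrthonormalBasis ℝ E' l)) y (stdOrthonormalBasis ℝ E' k)) +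
      𝔟₀ y (fderiv ℝ u y) + 𝔠₀ y (u y) := by
    funext y; rw [frameOp_apply, principalPart_apply]
  rw [heq]
  refine ((ContDiff.sum fun k _ ↦ ContDiff.sum fun l _ ↦ ?_).add
    (h𝔟.clm_apply (hu.fderiv_right (m := ∞) (by norm_cast)))).add (h𝔠.clm_apply hu)
  exact (contDiff_const.inner ℝ (hS.clm_apply contDiff_const)).smul (h2 _ _)

variable [FiniteDimensional ℝ F']

/-- **Passage to the limit in the equation, word by word.** Let the slab-smooth `f N` satisfy,
near every point of the open set `U`, `∂ₜ f_N = L_t f_N + Θ - r_N` with slab-smooth coefficient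
fields constant outside a ball, and let the frame words of `f N - F` and of `r N` tend to zero
uniformly on the slab (`F` with smooth slices and uniformly convergent word derivatives). Then
every word derivative of `F` is differentiable in time within `[0, T]` at the points of `U`, with
derivative the word derivative of `L_t F + Θ`. [cite: Evans2010, §7.1.2, Thm. 3] -/
theorem hasDerivWithinAt_words_of_limit {T : ℝ} (hT : 0 < T) {S : ℝ → E' → (E' →L[ℝ] E')}
    {𝔟 : ℝ → E' → ((E' →L[ℝ] F') →L[ℝ] F')} {𝔠 : ℝ → E' → (F' →L[ℝ] F')}
    (hS : IsSmoothSpaceTimeOn (Icc 0 T) S) (h𝔟 : IsSmoothSpaceTimeOn (Icc 0 T) 𝔟) (h𝔠 : IsSmoothSpaceTimeOn (Icc 0 T) 𝔠)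
    {Rc : ℝ} (hSc : ∀ s y, Rc ≤ ‖y‖ → S s y = 1) (h𝔟c : ∀ s y, Rc ≤ ‖y‖ → 𝔟 s y = 0) (h𝔠c : ∀ s y, Rc ≤ ‖y‖ → 𝔠 s y = 0)
    {Θ : ℝ → E' → F'} (hΘ : IsSmoothSpaceTimeOn (Icc 0 T) Θ) {f r : ℕ → ℝ → E' → F'}
    (hf : ∀ N, IsSmoothSpaceTimeOn (Icc 0 T) (f N)) (hr : ∀ N, IsSmoothSpaceTimeOn (Icc 0 T) (r N)) {U : Set E'}
    (heq : ∀ N, ∀ s ∈ Icc 0 T, ∀ x ∈ U, timeDerivWithin (Icc 0 T) (f N) s =ᶠ[𝓝 x]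
      fun y ↦ frameOp (S s y) (𝔟 s y) (𝔠 s y) (f N s) y + Θ s y - r N s y)
    {F : ℝ → E' → F'} (hFs : ∀ t ∈ Icc 0 T, ContDiff ℝ ∞ (F t))
    (hFu : ∀ β : List E', TendstoUniformlyOn (fun N (q : ℝ × E') ↦ iterDirDeriv β (f N q.1) q.2)
      (fun q ↦ iterDirDeriv β (F q.1) q.2) atTop (Icc 0 T ×ˢ univ))
    (hsmall : ∀ (m : ℕ) (ε : ℝ), 0 < ε → ∃ N₀ : ℕ, ∀ N ≥ N₀, ∀ w : List (Fin (Module.finrank ℝ E')), w.length ≤ m →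
      ∀ t ∈ Icc 0 T, ∀ y, ‖iterDirDeriv (w.map (stdOrthonormalBasis ℝ E')) (f N t) y -
        iterDirDeriv (w.map (stdOrthonormalBasis ℝ E')) (F t) y‖ ≤ ε)
    (hrsmall : ∀ (m : ℕ) (ε : ℝ), 0 < ε → ∃ N₀ : ℕ, ∀ N ≥ N₀, ∀ w : List (Fin (Module.finrank ℝ E')), w.length ≤ m →
      ∀ t ∈ Icc 0 T, ∀ y, ‖iterDirDeriv (w.map (stdOrthonormalBasis ℝ E')) (r N t) y‖ ≤ ε)
    (β : List E') {t : ℝ} (ht : t ∈ Icc 0 T) {x : E'} (hx : x ∈ U) :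
    HasDerivWithinAt (fun s ↦ iterDirDeriv β (F s) x)
      (iterDirDeriv β (fun y ↦ frameOp (S t y) (𝔟 t y) (𝔠 t y) (F t) y + Θ t y) x) (Icc 0 T) t := by
  set n : ℕ := Module.finrank ℝ E' with hn
  set m : ℕ := β.length with hm
  have hU := uniqueDiffOn_Icc hT
  have hfs : ∀ N, ∀ s ∈ Icc 0 T, ContDiff ℝ ∞ (f N s) := fun N s hs ↦ (hf N).contDiff_slice hs
  have hrs : ∀ N, ∀ s ∈ Icc 0 T, ContDiff ℝ ∞ (r N s) := fun N s hs ↦ (hr N).contDiff_slice hs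
  -- the right-hand sides
  obtain ⟨G, hG⟩ : ∃ G : ℕ → ℝ → E' → F', G = fun N s y ↦ frameOp (S s y) (𝔟 s y) (𝔠 s y) (f N s) y + Θ s y - r N s y := ⟨_, rfl⟩
  have hGap : ∀ N s, G N s = fun y ↦ frameOp (S s y) (𝔟 s y) (𝔠 s y) (f N s) y + Θ s y - r N s y := fun N s ↦ by rw [hG]
  have hGs : ∀ N, IsSmoothSpaceTimeOn (Icc 0 T) (G N) := fun N ↦ by
    rw [hG]; exact ((isSmoothSpaceTimeOn_frameOp hT hS h𝔟 h𝔠 (hf N)).add hΘ).sub (hr N)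
  -- (hf): derivatives of the word derivatives of `f N` within `[0, T]`
  have hderiv : ∀ N, ∀ s ∈ Icc 0 T, HasDerivWithinAt (fun s ↦ iterDirDeriv β (f N s) x) (iterDirDeriv β (G N s) x) (Icc 0 T) s := by
    intro N s hs
    have hW := isSmoothSpaceTimeOn_iterDirDeriv_Icc hT (hf N) β
    have h1 := hW.hasDerivWithinAt_timeDerivWithin hU hs x
    have h2 : timeDerivWithin (Icc 0 T) (fun s ↦ iterDirDeriv β (f N s)) s x = iterDirDeriv β (G N s) x := by
      rw [timeDerivWithin_iterDirDeriv hT (hf N) β hs x, hGap]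
      exact (eventuallyEq_iterDirDeriv (heq N s hs x hx) β).eq_of_nhds
    rw [h2] at h1
    exact h1
  -- (hf'c): continuity of the derivatives on `[0, T]`
  have hcont : ∀ N, ContinuousOn (fun s ↦ iterDirDeriv β (G N s) x) (Icc 0 T) := by
    intro N
    have hW := (isSmoothSpaceTimeOn_iterDirDeriv_Icc hT (hGs N) β).continuousOn
    exact hW.comp (continuousOn_id.prodMk continuousOn_const) fun s hs ↦ mk_mem_prod hs (mem_univ x)
  -- (hfg): pointwise convergence
  have hptw : ∀ s ∈ Icc 0 T, Tendsto (fun N ↦ iterDirDeriv β (f N s) x) atTop (𝓝 (iterDirDeriv β (F s) x)) := fun s hs ↦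
    (hFu β).tendsto_at (mk_mem_prod hs (mem_univ x))
  -- (hf'g'): uniform convergence of the derivatives on `[0, T]`
  obtain ⟨Mc, hMc0, hMc⟩ : ∃ Mc : ℝ, 0 ≤ Mc ∧ (∀ s ∈ Icc 0 T, ∀ j ≤ m, ∀ y, ‖iteratedFDeriv ℝ j (S s) y‖ ≤ Mc) ∧
      (∀ s ∈ Icc 0 T, ∀ j ≤ m, ∀ y, ‖iteratedFDeriv ℝ j (𝔟 s) y‖ ≤ Mc) ∧ (∀ s ∈ Icc 0 T, ∀ j ≤ m, ∀ y, ‖iteratedFDeriv ℝ j (𝔠 s) y‖ ≤ Mc) := by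
    obtain ⟨M₁, h₁0, h₁⟩ := exists_forall_iteratedFDeriv_slab_le hT hS hSc m
    obtain ⟨M₂, h₂0, h₂⟩ := exists_forall_iteratedFDeriv_slab_le hT h𝔟 h𝔟c m
    obtain ⟨M₃, h₃0, h₃⟩ := exists_forall_iteratedFDeriv_slab_le hT h𝔠 h𝔠c m
    refine ⟨M₁ + M₂ + M₃, by positivity, fun s hs j hj y ↦ (h₁ s hs j hj y).trans (by linarith),
      fun s hs j hj y ↦ (h₂ s hs j hj y).trans (by linarith), fun s hs j hj y ↦ (h₃ s hs j hj y).trans (by linarith)⟩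
  obtain ⟨hMS, hMB, hMC⟩ := hMc
  set Pb : ℝ := ∏ i, ‖β.get i‖ with hPb
  have hPb0 : 0 ≤ Pb := Finset.prod_nonneg fun i _ ↦ norm_nonneg _
  set Cfo : ℝ := ((n : ℝ) ^ 2 * 2 ^ m + n + 1) * (2 ^ m * (2 ^ m * Mc)) * ((n : ℝ) + 1) ^ m with hCfo
  have hCfo0 : 0 ≤ Cfo := by positivity
  have hunif : TendstoUniformlyOn (fun N s ↦ iterDirDeriv β (G N s) x)
      (fun s ↦ iterDirDeriv β (fun y ↦ frameOp (S s y) (𝔟 s y) (𝔠 s y) (F s) y + Θ s y) x) atTop (Icc 0 T) := by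
    rw [Metric.tendstoUniformlyOn_iff]
    intro ε hε
    -- smallness thresholds
    obtain ⟨N₁, hN₁⟩ := hsmall (m + 2) (ε / (4 * (Cfo * Pb + 1))) (by positivity)
    obtain ⟨N₂, hN₂⟩ := hrsmall m (ε / (4 * ((n : ℝ) ^ m * Pb + 1))) (by positivity)
    filter_upwards [Filter.eventually_ge_atTop (max N₁ N₂)] with N hN s hs
    have hN1 : N₁ ≤ N := (le_max_left _ _).trans hN
    have hN2 : N₂ ≤ N := (le_max_right _ _).trans hN
    rw [dist_eq_norm]
    -- the difference of the right-hand sides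
    have hu : ContDiff ℝ ∞ fun y ↦ F s y - f N s y := (hFs s hs).sub (hfs N s hs)
    have hlin : (fun y ↦ (frameOp (S s y) (𝔟 s y) (𝔠 s y) (F s) y + Θ s y) - G N s y) =
        fun y ↦ frameOp (S s y) (𝔟 s y) (𝔠 s y) (fun z ↦ F s z - f N s z) y + r N s y := by
      funext y
      simp only [hGap, frameOp_sub_fun _ _ _ (hFs s hs) (hfs N s hs)]
      abel
    have hSs := hS.contDiff_slice hs
    have h𝔟s := h𝔟.contDiff_slice hs
    have h𝔠s := h𝔠.contDiff_slice hs
    have hFO : ContDiff ℝ ∞ fun y ↦ frameOp (S s y) (𝔟 s y) (𝔠 s y) (fun z ↦ F s z - f N s z) y :=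
      contDiff_frameOp_slice hSs h𝔟s h𝔠s hu
    have hA : ContDiff ℝ ∞ fun y ↦ frameOp (S s y) (𝔟 s y) (𝔠 s y) (F s) y + Θ s y :=
      (contDiff_frameOp_slice hSs h𝔟s h𝔠s (hFs s hs)).add (hΘ.contDiff_slice hs)
    rw [← iterDirDeriv_sub_apply hA ((hGs N).contDiff_slice hs), hlin,
      show (fun y ↦ frameOp (S s y) (𝔟 s y) (𝔠 s y) (fun z ↦ F s z - f N s z) y + r N s y) =
        (fun y ↦ frameOp (S s y) (𝔟 s y) (𝔠 s y) (fun z ↦ F s z - f N s z) y) + r N s from rfl,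
      iterDirDeriv_add hFO (hrs N s hs), Pi.add_apply]
    refine (norm_add_le _ _).trans_lt ?_
    -- the frame-operator term
    have hδ0 : 0 ≤ ε / (4 * (Cfo * Pb + 1)) := by positivity
    have hwords : ∀ w : List (Fin n), w.length ≤ m + 2 → ∀ y,
        ‖iterDirDeriv (w.map (stdOrthonormalBasis ℝ E')) (fun z ↦ F s z - f N s z) y‖ ≤ ε / (4 * (Cfo * Pb + 1)) := by
      intro w hw y
      rw [iterDirDeriv_sub_apply (hFs s hs) (hfs N s hs), norm_sub_rev]
      exact hN₁ N hN1 w hw s hs y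
    have hT1 := norm_iterDirDeriv_frameOp_le hSs h𝔟s h𝔠s hMc0 (hMS s hs) (hMB s hs) (hMC s hs) hu hδ0 hwords β hm.symm x
    have hT1' : ‖iterDirDeriv β (fun y ↦ frameOp (S s y) (𝔟 s y) (𝔠 s y) (fun z ↦ F s z - f N s z) y) x‖ ≤ ε / 4 := by
      refine hT1.trans ?_
      have hX : Cfo * Pb * (ε / (4 * (Cfo * Pb + 1))) ≤ ε / 4 := by
        rw [div_eq_mul_inv, div_eq_mul_inv]
        have h4 : Cfo * Pb * (4 * (Cfo * Pb + 1))⁻¹ ≤ 4⁻¹ := by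
          rw [mul_inv, ← mul_assoc]
          calc Cfo * Pb * 4⁻¹ * (Cfo * Pb + 1)⁻¹ ≤ (Cfo * Pb + 1) * 4⁻¹ * (Cfo * Pb + 1)⁻¹ := by gcongr; linarith
            _ = 4⁻¹ := by field_simp
        calc Cfo * Pb * (ε * (4 * (Cfo * Pb + 1))⁻¹) = ε * (Cfo * Pb * (4 * (Cfo * Pb + 1))⁻¹) := by ring
          _ ≤ ε * 4⁻¹ := mul_le_mul_of_nonneg_left h4 hε.le
      calc _ = Cfo * Pb * (ε / (4 * (Cfo * Pb + 1))) := by rw [hCfo]; ring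
        _ ≤ ε / 4 := hX
    -- the residual term
    have hρ0 : 0 ≤ ε / (4 * ((n : ℝ) ^ m * Pb + 1)) := by positivity
    have hT2 := norm_iterDirDeriv_le_of_frame_words (hrs N s hs) β x hρ0 fun w hw ↦ hN₂ N hN2 w (by omega) s hs x
    have hT2' : ‖iterDirDeriv β (r N s) x‖ ≤ ε / 4 := by
      refine hT2.trans ?_
      have hpow : (Module.finrank ℝ E' : ℝ) ^ β.length = (n : ℝ) ^ m := by rw [hm]
      have hprod : ∏ i, ‖β.get i‖ = Pb := rfl
      rw [hpow, hprod]
      have h4 : (n : ℝ) ^ m * Pb * (4 * ((n : ℝ) ^ m * Pb + 1))⁻¹ ≤ 4⁻¹ := by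
        rw [mul_inv, ← mul_assoc]
        calc (n : ℝ) ^ m * Pb * 4⁻¹ * ((n : ℝ) ^ m * Pb + 1)⁻¹ ≤ ((n : ℝ) ^ m * Pb + 1) * 4⁻¹ * ((n : ℝ) ^ m * Pb + 1)⁻¹ := by
              gcongr; linarith
          _ = 4⁻¹ := by field_simp
      calc (n : ℝ) ^ m * (ε / (4 * ((n : ℝ) ^ m * Pb + 1))) * Pb = ε * ((n : ℝ) ^ m * Pb * (4 * ((n : ℝ) ^ m * Pb + 1))⁻¹) := by ring
        _ ≤ ε * 4⁻¹ := mul_le_mul_of_nonneg_left h4 hε.le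
        _ = ε / 4 := by ring
    linarith
  exact hasDerivWithinAt_of_tendstoUniformlyOn_Icc hderiv hcont hptw hunif ht

end Passage

end Literature.Analysis.PDE
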